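import Summits.BirchSwinnertonDyer.BirchSwinnertonDyer.Theorems.PrintCf2SplitBadTwoRestrictedSelmerBottomSelmerToTrueSelmer
import HarnessLib

/-!
# Crux `PrintCf2.SplitBadTwoRankOneOfFacts` (stmt-BirchSwinnertonDyer-20368), road α, stub S3c — (F2) ASSEMBLED: the Ш-image of the summand's
# true Selmer group IS the `𝔮_r`-eigen part of `P(Sel_{p^∞}(E_K/K)) = Ш(E_K/K) ∩ im(H¹(K, E[p^∞]) → H¹(K, E))`

Cell `bsd-print-cf2`, width seat `bsd-line-cf2-p1-w7` g2, file 12 (assembly of p665244, p666248, p667462, p667915); `--supports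
stmt-BirchSwinnertonDyer-20368` (helper, Theses-free). HONEST FRAMING: nothing here closes a crux or a stub; BSD is not proved by any of this; no summit
statement is proved by this seat. No definition, no named fact, no `sorry`, no kit. beyond-print theorem: no.

`mem_map_selmer_and_eigen_of_mem_range_shaMap` (⊆) and `mem_range_shaMap_trueSelmer_of_eigen` (⊇): on an imaginary quadratic base with `p = v·v̄`,
for `M_r = E[𝔮_r^∞]` with complementary `M_{r′}` (`r − r′` a unit) and an equivariant `f₀` acting as `r`/`r′` on the two summands with local points
maps, GRANTED the CM input (H1″) at `v`: the range of the Ш-map `f` on `𝔖_v(K, M_r) ⊓ L_{M_r}` is EXACTLY the set of `r`-eigen classes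
(`∀ k N, p^k x = 0 → N ≡ r (p^k) → galH1Map f₀ x = N x`) of `P(Sel_{p^∞}(E_K/K))` (`= Ш ⊓ im P`, tree `map_primaryH1ToH1_selmerGroupPInfty_eq_sha_inf_range`).
So the middle factor of the bottom value (p665244: `#((𝔖_v ⊓ L_M)/Q_M) = #f(𝔖_v ⊓ L_M)`) is `#C_r` for -w8's eigen subgroup `C_r ⊆ Ш(E_K/K)[2^∞]`.
[cite: Agboola2007, §6 (Ш(K)(𝔭*))] [cite: Rubin1999, §2]
-/

noncomputable section

open scoped Classical

set_option linter.dupNamespace false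
set_option autoImplicit false

open NumberField IsDedekindDomain Field WeierstrassCurve
open Literature.NumberTheory.EllipticCurves Literature.NumberTheory.EllipticCurves.GreenbergSelmer
open Literature.NumberTheory.EllipticCurves.Castella2018.AcSelmer
open Literature.NumberTheory.EllipticCurves.Agboola2007
open Literature.NumberTheory.EllipticCurves.ResKernel
open Literature.NumberTheory.GaloisRepresentations

universe u

namespace Summit.BirchSwinnertonDyer.BirchSwinnertonDyer.Theorems.PrintCf2.RestrictedSelmerPair

section Assembly

variable {K : Type u} [Field K] [NumberField K] (V : WeierstrassCurve K) [V.IsElliptic] (p : ℕ) [Fact p.Prime]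
  (π : V.endRing) (r r' : ℤ_[p]) (v vbar : HeightOneSpectrum (𝓞 K))
  (f₀ : V.geomPoints →+ V.geomPoints) (hf₀ : ∀ (σ : absoluteGaloisGroup K) (P : V.geomPoints), f₀ (σ • P) = σ • f₀ P)
  (hfr : ∀ (k : ℕ) (N : ℤ) (x : V.geomPrimaryTorsion p), x ∈ V.endEigenPrimaryTorsion p π r → p ^ k • x = 0 →
    ((N : ℤ_[p]) - r) ∈ (Ideal.span {(p : ℤ_[p]) ^ k} : Ideal ℤ_[p]) → f₀ (x : V.geomPoints) = N • (x : V.geomPoints))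

include hfr in
/-- **(⊆)** every class in `f(𝔖_v(K, M_r) ⊓ L_{M_r})` lies in `P(Sel_{p^∞}(E_K/K))` and is `r`-eigen for `galH1Map f₀` (p665244 + p666248; `v`, `v̄` the
places above `p`). [cite: Agboola2007, §6] -/
theorem mem_map_selmer_and_eigen_of_mem_range_shaMap (hK : IsImaginaryQuadratic K)
    (hall : ∀ w : HeightOneSpectrum (𝓞 K), ((p : ℕ) : 𝓞 K) ∈ w.asIdeal → w = v ∨ w = vbar) {x : V.galH1}
    (hx : x ∈ (((V.primaryH1ToH1 p).comp (AddEquiv.ofBijective (resSubgroup ⊤ (V.geomPrimaryTorsion p))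
        (resSubgroup_top_bijective (V.geomPrimaryTorsion p))).symm.toAddMonoidHom).comp
      ((resH1Hom (ContinuousMonoidHom.id _) (V.endEigenPrimaryTorsion p π r).subtype (fun _ _ ↦ rfl)).comp
        (restrictedSelmerBase ↥(V.endEigenPrimaryTorsion p π r) p v ⊓
            (V.localKerOver p ⊤ (vbar.adicCompletion K)).comap
              (resH1Hom (ContinuousMonoidHom.id _) (V.endEigenPrimaryTorsion p π r).subtype (fun _ _ ↦ rfl))).subtype)).range) :
    x ∈ (V.selmerGroupPInfty p).map (V.primaryH1ToH1 p) ∧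
      ∀ (k : ℕ) (N : ℤ), p ^ k • x = 0 → ((N : ℤ_[p]) - r) ∈ (Ideal.span {(p : ℤ_[p]) ^ k} : Ideal ℤ_[p]) →
        galH1Map f₀ hf₀ x = N • x := by
  refine ⟨?_, fun k N hk hN ↦ galH1Map_eq_zsmul_of_mem_range_shaMap V p π r f₀ hf₀ hfr _ hx k N hk hN⟩
  rw [V.map_primaryH1ToH1_selmerGroupPInfty_eq_sha_inf_range p]
  refine AddSubgroup.mem_inf.mpr ⟨(natCard_trueSelmer_quotient_eq_natCard_range_shaMap V p π r v vbar hK hall).2 hx, ?_⟩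
  obtain ⟨c, rfl⟩ := hx
  exact ⟨_, rfl⟩

variable (hfr' : ∀ (k : ℕ) (N : ℤ) (x : V.geomPrimaryTorsion p), x ∈ V.endEigenPrimaryTorsion p π r' → p ^ k • x = 0 →
    ((N : ℤ_[p]) - r') ∈ (Ideal.span {(p : ℤ_[p]) ^ k} : Ideal ℤ_[p]) → f₀ (x : V.geomPoints) = N • (x : V.geomPoints))

include hfr hfr' in
/-- **(⊇)** every `r`-eigen class of `P(Sel_{p^∞}(E_K/K))` lies in `f(𝔖_v(K, M_r) ⊓ L_{M_r})`, GRANTED `HasLocalPointsMaps f₀` and the CM input (H1″)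
at `v` (p667462 + p667915). Together with (⊆): the middle factor of the bottom value counts EXACTLY the `r`-eigen classes of `Ш(E_K/K) ∩ im P`.
[cite: Agboola2007, §6] [cite: Rubin1999, §2] -/
theorem mem_range_shaMap_trueSelmer_of_eigen (hK : IsImaginaryQuadratic K)
    (hinf : V.endEigenPrimaryTorsion p π r ⊓ V.endEigenPrimaryTorsion p π r' = ⊥)
    (hsup : V.endEigenPrimaryTorsion p π r ⊔ V.endEigenPrimaryTorsion p π r' = ⊤) (hunit : IsUnit (r - r'))
    (hloc : HasLocalPointsMaps V V f₀)
    (hH1 : (V.localKerOver p ⊤ (v.adicCompletion K)).comap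
        (resH1Hom (ContinuousMonoidHom.id _) (V.endEigenPrimaryTorsion p π r).subtype (fun _ _ ↦ rfl)) ≤
      (resOfLe ↥(V.endEigenPrimaryTorsion p π r) (inf_le_left : ⊤ ⊓ decomp v ≤ ⊤)).ker)
    {x : V.galH1} (hxSel : x ∈ (V.selmerGroupPInfty p).map (V.primaryH1ToH1 p))
    (hxEig : ∀ (k : ℕ) (N : ℤ), p ^ k • x = 0 → ((N : ℤ_[p]) - r) ∈ (Ideal.span {(p : ℤ_[p]) ^ k} : Ideal ℤ_[p]) →
        galH1Map f₀ hf₀ x = N • x) :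
    x ∈ (((V.primaryH1ToH1 p).comp (AddEquiv.ofBijective (resSubgroup ⊤ (V.geomPrimaryTorsion p))
        (resSubgroup_top_bijective (V.geomPrimaryTorsion p))).symm.toAddMonoidHom).comp
      ((resH1Hom (ContinuousMonoidHom.id _) (V.endEigenPrimaryTorsion p π r).subtype (fun _ _ ↦ rfl)).comp
        (restrictedSelmerBase ↥(V.endEigenPrimaryTorsion p π r) p v ⊓
            (V.localKerOver p ⊤ (vbar.adicCompletion K)).comap
              (resH1Hom (ContinuousMonoidHom.id _) (V.endEigenPrimaryTorsion p π r).subtype (fun _ _ ↦ rfl))).subtype)).range := by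
  obtain ⟨y₀, hy₀, rfl⟩ := AddSubgroup.mem_map.mp hxSel
  set Re := AddEquiv.ofBijective (resSubgroup (⊤ : Subgroup (absoluteGaloisGroup K)) (V.geomPrimaryTorsion p))
    (resSubgroup_top_bijective (G := absoluteGaloisGroup K) (V.geomPrimaryTorsion p)) with hRe
  -- the projectors
  obtain ⟨e, he₁, he₂, hesub, he⟩ := exists_eigenProjector V p π r r' hinf hsup
  obtain ⟨e', he'₁, he'₂, -, he'⟩ := exists_eigenProjector V p π r' r (by rw [inf_comm]; exact hinf) (by rw [sup_comm]; exact hsup)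
  have hsum := coe_proj_add_coe_proj V p π r r' e e' hesub he'₁ he'₂
  set y := resSubgroup (⊤ : Subgroup (absoluteGaloisGroup K)) (V.geomPrimaryTorsion p) y₀ with hydef
  have hy : Re.symm.toAddMonoidHom y = y₀ := Re.symm_apply_apply y₀
  -- `P y₀ = (P ∘ Re⁻¹) y`
  have hx' : V.primaryH1ToH1 p y₀ = ((V.primaryH1ToH1 p).comp Re.symm.toAddMonoidHom) y := by
    rw [AddMonoidHom.comp_apply, hy]
  rw [hx'] at hxEig ⊢
  -- the eigen class comes from `e_* y` (p667462) …
  have heq := primaryH1ToH1_eq_of_eigen V p π r r' f₀ hf₀ hfr hfr' hinf hsup hunit e hesub he y hxEig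
  -- … which lies in the true Selmer group (p667915)
  have hmem := proj_resSubgroup_mem_trueSelmer V p π r r' f₀ hf₀ hfr hfr' hunit hloc e e' he he' hsum v vbar hK hinf hsup hH1 hy₀
  rw [heq]
  exact ⟨⟨_, hmem⟩, rfl⟩

end Assembly

end Summit.BirchSwinnertonDyer.BirchSwinnertonDyer.Theorems.PrintCf2.RestrictedSelmerPair

end
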